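import Summits.MatrixMultiplication.MatrixMultiplication.Theses.EisensteinValCertificates
import Summits.MatrixMultiplication.MatrixMultiplication.Theses.FourierTwoFamiliesModP
import Literature.Computability.AlgebraicComplexity.SimultaneousDoubleProduct
import Summits.MatrixMultiplication.MatrixMultiplication.Theorems.EisensteinValCertificatesHomocyclicSTPPDesignsStubDesignLift
import Summits.MatrixMultiplication.MatrixMultiplication.Theorems.FourierTwoFamiliesModPCyclicReduction
import Summits.MatrixMultiplication.MatrixMultiplication.Theses.GroupTheoreticSTPP

/-!
# `HomocyclicSTPPDesigns` from prime two families (line `registered`: composition + reduction)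

Crux `EisensteinValCertificates.HomocyclicSTPPDesigns` (stmt-MatrixMultiplication-10647) = X′: for every
`ε > 0` some prime power `q`, some `ℓ` and some STPP family `(A_i,B_i,C_i)_{i<N}` in `(ℤ/q)^ℓ` (tree
`IsSTPP`) with `q^ℓ < Σ_i (|A_i||B_i||C_i|)^{(2+ε)/3}`.

This support file lands the COMPOSITION of the line `Cruxes/HomocyclicSTPPDesigns/Lines/birth.lean`
(the two-families lift of Cohn–Kleinberg–Szegedy–Umans 2005 §4/§6.2 at prime moduli, as recalled in
the proof of Pratt 2024 Thm 4.7): the two registered stub SIGNATURES imply the crux BY NAME.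

* hypothesis 1 = `FourierTwoFamiliesModP.PrimeTwoFamilies` (item stmt-MatrixMultiplication-14308, CKSU
  Conj. 4.7 with prime cyclic hosts; OPEN, conjecture-grade): for every `δ > 0` and arbitrarily large
  `n`, a prime `p ≤ n^{2+δ}` and `n` SDPP pairs `(A_i,B_i)` in `ℤ/p` with `|A_i||B_i| ≥ n^{2-δ}`;
* hypothesis 2 = the design lift (stub `stub_designLift`, provable now): for every `δ > 0` and all
  large `n`, every SDPP family of `n` pairs in an abelian group `H` yields an STPP family of
  `N ≥ n^{2-δ}` triples in `Fin 3 → H` whose size products are products of three of the `|A_i||B_i|`.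

Arithmetic of `homocyclicSTPPDesigns_of_lift`: given `ε > 0` put `δ := ε/(8+ε)` (so `0 < δ < 1` and
`3(2+δ) < (2-δ) + (2-δ)(2+ε)`); take the SDPP family at this `δ` with `n ≥ max(n₁, 2)`, lift it, and
count `p³ ≤ n^{3(2+δ)} < n^{(2-δ)+(2-δ)(2+ε)} ≤ N · n^{(2-δ)(2+ε)} ≤ Σ_v (|A'_v||B'_v||C'_v|)^{(2+ε)/3}`;
the witness is `q := p` (a prime is a prime power), `ℓ := 3`.

`homocyclicSTPPDesigns_of_primeTwoFamilies` discharges hypothesis 2 by the landed stub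
`DesignLift.stub_designLift` (Theorems/EisensteinValCertificatesHomocyclicSTPPDesignsStubDesignLift.lean):
the REDUCTION `PrimeTwoFamilies → HomocyclicSTPPDesigns` between the two route items
(stmt-MatrixMultiplication-14308 ⟹ stmt-MatrixMultiplication-10647), unconditional and sorry-free — the
skeleton of line `registered` closed modulo its single conjecture-grade stub.

Two bookkeeping corollaries place X′ among the tree's abelian design statements (the SANDWICH
`CPackingConstruction ⟺ PrimeTwoFamilies ⟹ X′ ⟹ CThesis ⟹ ω = 2`):
`homocyclicSTPPDesigns_of_cPackingConstruction` — CKSU Conj. 4.7 over ALL finite abelian groups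
(`GroupTheoreticSTPP.CPackingConstruction`, stmt-0595) implies X′, through the landed cyclic reduction
`cyclicReduction_proof : CyclicReduction` (Umans' reduction, Pratt 2024 p. 10); and
`cThesis_of_homocyclicSTPPDesigns` — X′ implies the all-abelian STPP apex `GroupTheoreticSTPP.CThesis`
(stmt-0593; take `H := Fin ℓ → ZMod q`, `|H| = q^ℓ`), as sketched by the crux strategist
(Cruxes/HomocyclicSTPPDesigns/SketchStrategist.lean §1).
-/

-- single-conjunct summit: the mandated namespace repeats `MatrixMultiplication` (summit = sub-problem).
set_option linter.dupNamespace false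

namespace Summit.MatrixMultiplication.MatrixMultiplication.Theorems.HomocyclicSTPPDesigns

open Summit.MatrixMultiplication.MatrixMultiplication.Theses.EisensteinValCertificates
open Summit.MatrixMultiplication.MatrixMultiplication.Theses.FourierTwoFamiliesModP (PrimeTwoFamilies)
open Literature.Computability.AlgebraicComplexity
open scoped BigOperators

/-- COMPOSITION of line `registered` (two-families lift): `PrimeTwoFamilies` (CKSU Conj. 4.7 at prime
moduli, item stmt-MatrixMultiplication-14308) together with the design lift (every SDPP family of `n`
pairs in an abelian `H` yields, for large `n`, an STPP family of `N ≥ n^{2-δ}` triples in `Fin 3 → H`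
with size products `(|A_i||B_i|)(|A_j||B_j|)(|A_k||B_k|)`) gives the crux `HomocyclicSTPPDesigns`:
with `δ := ε/(8+ε)` the lifted family in `Fin 3 → ZMod p` has packing sum at exponent `(2+ε)/3`
at least `N · n^{(2-δ)(2+ε)} ≥ n^{(2-δ)+(2-δ)(2+ε)} > n^{3(2+δ)} ≥ p³`. -/
theorem homocyclicSTPPDesigns_of_lift
    (hTF : PrimeTwoFamilies)
    (hLift : ∀ δ : ℝ, 0 < δ → ∃ n₁ : ℕ, ∀ n ≥ n₁, ∀ (H : Type) [AddCommGroup H]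
      (A B : Fin n → Finset H), IsSDPP A B →
      ∃ (N : ℕ) (A' B' C' : Fin N → Finset (Fin 3 → H)),
        IsSTPP A' B' C' ∧ (n : ℝ) ^ (2 - δ) ≤ N ∧
        ∀ v : Fin N, ∃ i j k : Fin n,
          (A' v).card * (B' v).card * (C' v).card =
            ((A i).card * (B i).card) * ((A j).card * (B j).card) * ((A k).card * (B k).card)) :
    HomocyclicSTPPDesigns := by
  intro ε hε
  -- the slack `δ`
  obtain ⟨δ, hδ, hδ1, hkey⟩ :
      ∃ δ : ℝ, 0 < δ ∧ δ < 1 ∧ 3 * (2 + δ) < (2 - δ) + (2 - δ) * (2 + ε) := by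
    refine ⟨ε / (8 + ε), by positivity, ?_, ?_⟩
    · rw [div_lt_one (by positivity)]
      linarith
    · have h8 : (8 : ℝ) + ε ≠ 0 := by positivity
      have h1 : ε / (8 + ε) * (8 + ε) = ε := div_mul_cancel₀ ε h8
      have h0 : 0 < ε / (8 + ε) := by positivity
      nlinarith [h1, h0, hε]
  -- the lift threshold and the SDPP family
  obtain ⟨n₁, hn₁⟩ := hLift δ hδ
  obtain ⟨n, hn, p, hp, A, B, hW, hX, hpn, hAB⟩ := hTF δ hδ (n₁ + 2)
  obtain ⟨N, A', B', C', hS, hN, hprod⟩ := hn₁ n (by omega) (ZMod p) A B ⟨hW, hX⟩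
  refine ⟨p, 3, hp.isPrimePow, N, A', B', C', hS, ?_⟩
  -- arithmetic
  have hn1 : (1 : ℝ) < n := by exact_mod_cast (show 1 < n by omega)
  have hnpos : (0 : ℝ) < n := by linarith
  have hYpos : (0 : ℝ) < (n : ℝ) ^ (2 - δ) := Real.rpow_pos_of_pos hnpos _
  -- the host: `p³ ≤ n^{3(2+δ)}`
  have hhost : (p : ℝ) ^ 3 ≤ (n : ℝ) ^ (3 * (2 + δ)) := by
    calc (p : ℝ) ^ 3 ≤ ((n : ℝ) ^ (2 + δ)) ^ 3 := by gcongr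
      _ = (n : ℝ) ^ (3 * (2 + δ)) := by
          rw [← Real.rpow_natCast ((n : ℝ) ^ (2 + δ)) 3, ← Real.rpow_mul hnpos.le]
          congr 1
          push_cast
          ring
  -- each term of the packing sum is at least `n^{(2-δ)(2+ε)}`
  have hterm : ∀ v : Fin N, (n : ℝ) ^ ((2 - δ) * (2 + ε)) ≤
      (((A' v).card * (B' v).card * (C' v).card : ℕ) : ℝ) ^ ((2 + ε) / 3) := by
    intro v
    obtain ⟨i, j, k, hijk⟩ := hprod v
    have hcast : (((A' v).card * (B' v).card * (C' v).card : ℕ) : ℝ) =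
        (((A i).card * (B i).card : ℕ) : ℝ) * (((A j).card * (B j).card : ℕ) : ℝ) *
          (((A k).card * (B k).card : ℕ) : ℝ) := by
      rw [hijk]
      push_cast
      ring
    have h1 := hAB i
    have h2 := hAB j
    have h3 := hAB k
    have h12 : (n : ℝ) ^ (2 - δ) * (n : ℝ) ^ (2 - δ) ≤
        (((A i).card * (B i).card : ℕ) : ℝ) * (((A j).card * (B j).card : ℕ) : ℝ) :=
      mul_le_mul h1 h2 hYpos.le (hYpos.le.trans h1)
    have hYYY : (n : ℝ) ^ (2 - δ) * (n : ℝ) ^ (2 - δ) * (n : ℝ) ^ (2 - δ) ≤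
        (((A' v).card * (B' v).card * (C' v).card : ℕ) : ℝ) := by
      rw [hcast]
      calc (n : ℝ) ^ (2 - δ) * (n : ℝ) ^ (2 - δ) * (n : ℝ) ^ (2 - δ)
          ≤ (((A i).card * (B i).card : ℕ) : ℝ) * (((A j).card * (B j).card : ℕ) : ℝ) *
              (n : ℝ) ^ (2 - δ) := mul_le_mul_of_nonneg_right h12 hYpos.le
        _ ≤ (((A i).card * (B i).card : ℕ) : ℝ) * (((A j).card * (B j).card : ℕ) : ℝ) *
              (((A k).card * (B k).card : ℕ) : ℝ) :=
            mul_le_mul_of_nonneg_left h3 ((mul_pos hYpos hYpos).le.trans h12)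
    have hY3 : ((n : ℝ) ^ (2 - δ) * (n : ℝ) ^ (2 - δ) * (n : ℝ) ^ (2 - δ)) ^ ((2 + ε) / 3) =
        (n : ℝ) ^ ((2 - δ) * (2 + ε)) := by
      rw [← Real.rpow_add hnpos, ← Real.rpow_add hnpos, ← Real.rpow_mul hnpos.le]
      congr 1
      ring
    rw [← hY3]
    exact Real.rpow_le_rpow (mul_pos (mul_pos hYpos hYpos) hYpos).le hYYY (by positivity)
  -- summing over the `N` triples
  have hsum : (N : ℝ) * (n : ℝ) ^ ((2 - δ) * (2 + ε)) ≤
      ∑ v : Fin N, (((A' v).card * (B' v).card * (C' v).card : ℕ) : ℝ) ^ ((2 + ε) / 3) := by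
    have h1 := Finset.sum_le_sum fun v (_ : v ∈ (Finset.univ : Finset (Fin N))) => hterm v
    rw [Finset.sum_const, Finset.card_univ, Fintype.card_fin, nsmul_eq_mul] at h1
    exact h1
  have hlow : (n : ℝ) ^ ((2 - δ) + (2 - δ) * (2 + ε)) ≤ (N : ℝ) * (n : ℝ) ^ ((2 - δ) * (2 + ε)) := by
    rw [Real.rpow_add hnpos]
    exact mul_le_mul_of_nonneg_right hN (Real.rpow_nonneg hnpos.le _)
  have hlt : (n : ℝ) ^ (3 * (2 + δ)) < (n : ℝ) ^ ((2 - δ) + (2 - δ) * (2 + ε)) :=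
    Real.rpow_lt_rpow_of_exponent_lt hn1 hkey
  have hp3 : ((p : ℕ) : ℝ) ^ (3 : ℕ) = (p : ℝ) ^ 3 := by norm_num
  calc (p : ℝ) ^ (3 : ℕ) ≤ (n : ℝ) ^ (3 * (2 + δ)) := hhost
    _ < (n : ℝ) ^ ((2 - δ) + (2 - δ) * (2 + ε)) := hlt
    _ ≤ (N : ℝ) * (n : ℝ) ^ ((2 - δ) * (2 + ε)) := hlow
    _ ≤ ∑ v : Fin N, (((A' v).card * (B' v).card * (C' v).card : ℕ) : ℝ) ^ ((2 + ε) / 3) := hsum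

/-- REDUCTION (line `registered` closed modulo its conjecture-grade stub): CKSU Conj. 4.7 with prime
cyclic hosts (`FourierTwoFamiliesModP.PrimeTwoFamilies`, item stmt-MatrixMultiplication-14308) implies
the crux `EisensteinValCertificates.HomocyclicSTPPDesigns` (stmt-MatrixMultiplication-10647) — the
composition `homocyclicSTPPDesigns_of_lift` with its lift hypothesis discharged by the landed
`DesignLift.stub_designLift` (CKSU 2005 §6.2 two-families lift on a Behrend corner-free index set,
output in `Fin 3 → H`). -/
theorem homocyclicSTPPDesigns_of_primeTwoFamilies : PrimeTwoFamilies → HomocyclicSTPPDesigns :=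
  fun hTF => homocyclicSTPPDesigns_of_lift hTF DesignLift.stub_designLift

/-- SANDWICH, lower end: CKSU Conj. 4.7 over all finite abelian groups
(`GroupTheoreticSTPP.CPackingConstruction`, item stmt-0595 of route GroupTheoreticSTPP) implies the crux
`HomocyclicSTPPDesigns` — by the landed cyclic reduction `cyclicReduction_proof`
(`CPackingConstruction`'s text `↔ PrimeTwoFamilies`, Theorems/FourierTwoFamiliesModPCyclicReduction.lean)
and `homocyclicSTPPDesigns_of_primeTwoFamilies`. -/
theorem homocyclicSTPPDesigns_of_cPackingConstruction
    (hC : Summit.MatrixMultiplication.MatrixMultiplication.Theses.GroupTheoreticSTPP.CPackingConstruction) :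
    HomocyclicSTPPDesigns :=
  homocyclicSTPPDesigns_of_primeTwoFamilies
    (Summit.MatrixMultiplication.MatrixMultiplication.Theorems.cyclicReduction_proof.1 hC)

/-- SANDWICH, upper end (crux strategist, SketchStrategist.lean §1): the crux `HomocyclicSTPPDesigns`
implies the all-abelian STPP apex `GroupTheoreticSTPP.CThesis` (item stmt-0593: for every `ε > 0` some
finite abelian `H` and an STPP family with `|H| < Σ_i (|A_i||B_i||C_i|)^{(2+ε)/3}`) — take
`H := Fin ℓ → ZMod q`, whose cardinality is `q^ℓ` (`Fintype.card_fun`, `ZMod.card`). -/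
theorem cThesis_of_homocyclicSTPPDesigns (h : HomocyclicSTPPDesigns) :
    Summit.MatrixMultiplication.MatrixMultiplication.Theses.GroupTheoreticSTPP.CThesis := by
  intro ε hε
  obtain ⟨q, ℓ, hq, N, A, B, C, hS, hlt⟩ := h ε hε
  haveI : NeZero q := ⟨hq.ne_zero⟩
  refine ⟨Fin ℓ → ZMod q, inferInstance, inferInstance, N, A, B, C, (isSTPP_iff A B C).1 hS, ?_⟩
  have hcard : (Fintype.card (Fin ℓ → ZMod q) : ℝ) = (q : ℝ) ^ ℓ := by
    rw [Fintype.card_fun, ZMod.card, Fintype.card_fin]; push_cast; rfl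
  rw [hcard]
  exact hlt

end Summit.MatrixMultiplication.MatrixMultiplication.Theorems.HomocyclicSTPPDesigns
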